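import Mathlib
import HarnessLib

/-!
# QUANT lane R8, front "FAR beyond trees", layer one — TWO-ANCHOR BLOCKS, real-algebra core: a block whose relays hang at two
# vertices dominates a mixture of its decoupled version and the exit point

builds on p205010 (kernel theorem, internal audit signed; external expert review pending)

Support file (`--supports stmt-CriticalPhenomena-4575`), seat `prim-quant-p1` (gen 19); memo
`run/shared/lean/prim/quant/prim-quant-p1-g19/FOR-LEAD-CACTI.md` §3 (kernel plan §5, file K4).  Pure real algebra; standard axioms;
no sorries; no definitions.

**Setting (law level).**  A pendant block hangs at a cut vertex `c`; its relays are the tips of two hair bundles `Y₁, Y₂` attached at two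
block vertices `v₁, v₂` ("anchors").  Write `Iᵢ = 𝟙[c ↔ vᵢ inside the block]`, `mᵢ = P(Iᵢ)`, `p₁₁ = P(I₁ I₂)` — by Harris
`m₁ m₂ ≤ p₁₁ ≤ min(m₁, m₂)` — and for the (independent) bundles `sᵢ = P(Yᵢ = 1)`, `dᵢ = P(Yᵢ ≥ 2)`, `uᵢ = sᵢ + dᵢ ≤ 1`.  The block count
`X = I₁Y₁ + I₂Y₂` has
  `h_S = P(X ≥ 1) = m₁u₁ + m₂u₂ − p₁₁u₁u₂`,  `t_S = P(X ≥ 2) = m₁d₁ + m₂d₂ + p₁₁(s₁u₂ − u₁d₂)`,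
and the DECOUPLED block (independent stems `Bernoulli(mᵢ)` at `c` carrying the same bundles — a pendant tree) has `(h', t')` = the same
expressions with `p₁₁ ↦ m₁m₂`.  Let `q ≤ m₁u₁`, `q ≤ m₂u₂` (e.g. `q` = the least tip marginal).

* `Quant.Block.twoAnchor_caseA` — if `u₁d₂ ≤ s₁u₂` then `u₁u₂(q − t') ≤ (s₁u₂ − u₁d₂)(h' − q)`: the key cancellation
  `(s₁u₂ − u₁d₂)h' + u₁u₂t' = m₁u₁²s₂ + m₂u₂²s₁` (the `m₁m₂` terms cancel) against `q(u₁s₂ + s₁u₂)`.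
* `Quant.Block.twoAnchor_caseB` — if `s₁u₂ < u₁d₂` (both bundles heavy) then `q ≤ t_S` (EXIT regime): `t_S ≥ m₁d₁(1−u₂) + m₁u₁s₂ + m₂d₂`
  (`p₁₁ ≤ m₁`) and `u₁u₂ · (…) ≥ q(u₁u₂ + (1−u₂)(u₁d₂ − s₁u₂))`.
* `Quant.Block.twoAnchor_one_le_two` — `t_S ≤ h_S`.
* **`Quant.Block.twoAnchor_dominates`** — there is `λ ∈ [0,1]` with `λh' + (1−λ)q ≤ h_S` and `λt' + (1−λ)q ≤ t_S`: the point `(h_S, t_S)`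
  dominates a convex combination of the decoupled point `(h', t')` and the exit point `(q, q)`.  With the block-transfer theorem (file K3)
  this replaces any two-anchor pendant block by two independent bundles at the cut vertex without increasing `P(N ≤ 1)` beyond the
  layer-one bound (memo §3: FAR at layer one on triangle cacti).
Numerics (memo §4, exact rationals): 0 failures; the covariance move `S = S' + ε(−u₁u₂, s₁u₂ − u₁d₂)`, `ε = p₁₁ − m₁m₂ ≥ 0`, is the whole
content of the correlation between the two anchors.  [this work]
-/

namespace Summit.CriticalPhenomena.PercolationContinuityZ3.Theorems

namespace Quant

namespace Block

/-- **Case A (light side): the decoupling inequality.**  If `u₁d₂ ≤ s₁u₂` then `u₁u₂(q − t') ≤ (s₁u₂ − u₁d₂)(h' − q)` where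
`h' = m₁u₁ + m₂u₂ − m₁m₂u₁u₂`, `t' = m₁d₁ + m₂d₂ + m₁m₂(s₁u₂ − u₁d₂)`; uses only `q ≤ mᵢuᵢ`, `uᵢ = sᵢ + dᵢ`, `sᵢ, dᵢ ≥ 0`. [this work] -/
theorem twoAnchor_caseA (m₁ m₂ s₁ d₁ s₂ d₂ q : ℝ)
    (hs₁ : 0 ≤ s₁) (hd₁ : 0 ≤ d₁) (hs₂ : 0 ≤ s₂) (hd₂ : 0 ≤ d₂)
    (hq₁ : q ≤ m₁ * (s₁ + d₁)) (hq₂ : q ≤ m₂ * (s₂ + d₂)) :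
    (s₁ + d₁) * (s₂ + d₂) * (q - (m₁ * d₁ + m₂ * d₂ + m₁ * m₂ * (s₁ * (s₂ + d₂) - (s₁ + d₁) * d₂))) ≤
      (s₁ * (s₂ + d₂) - (s₁ + d₁) * d₂) *
        ((m₁ * (s₁ + d₁) + m₂ * (s₂ + d₂) - m₁ * m₂ * (s₁ + d₁) * (s₂ + d₂)) - q) := by
  -- the identity `κ' h' + u₁u₂ t' = m₁u₁²s₂ + m₂u₂²s₁` and `u₁u₂ + κ' = u₁s₂ + s₁u₂`
  have key : (s₁ * (s₂ + d₂) - (s₁ + d₁) * d₂) *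
        ((m₁ * (s₁ + d₁) + m₂ * (s₂ + d₂) - m₁ * m₂ * (s₁ + d₁) * (s₂ + d₂)) - q) -
      (s₁ + d₁) * (s₂ + d₂) * (q - (m₁ * d₁ + m₂ * d₂ + m₁ * m₂ * (s₁ * (s₂ + d₂) - (s₁ + d₁) * d₂))) =
      (m₁ * (s₁ + d₁) - q) * ((s₁ + d₁) * s₂) + (m₂ * (s₂ + d₂) - q) * ((s₂ + d₂) * s₁) := by ring
  have h1 : 0 ≤ (m₁ * (s₁ + d₁) - q) * ((s₁ + d₁) * s₂) :=
    mul_nonneg (by linarith) (mul_nonneg (by linarith) hs₂)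
  have h2 : 0 ≤ (m₂ * (s₂ + d₂) - q) * ((s₂ + d₂) * s₁) :=
    mul_nonneg (by linarith) (mul_nonneg (by linarith) hs₁)
  linarith [key, h1, h2]

/-- **Case B (both bundles heavy): exit.**  If `s₁u₂ < u₁d₂` then `q ≤ t_S = m₁d₁ + m₂d₂ + p₁₁(s₁u₂ − u₁d₂)` (`p₁₁ ≤ m₁`, `uᵢ ≤ 1`,
`q ≤ mᵢuᵢ`): the least tip is reached no more often than two tips at once. [this work] -/
theorem twoAnchor_caseB (m₁ m₂ p₁₁ s₁ d₁ s₂ d₂ q : ℝ)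
    (hm₁ : 0 ≤ m₁) (hm₂ : 0 ≤ m₂) (hp₁ : p₁₁ ≤ m₁)
    (hs₁ : 0 ≤ s₁) (hd₁ : 0 ≤ d₁) (hs₂ : 0 ≤ s₂) (hd₂ : 0 ≤ d₂) (hu₂ : s₂ + d₂ ≤ 1)
    (hq₁ : q ≤ m₁ * (s₁ + d₁)) (hq₂ : q ≤ m₂ * (s₂ + d₂))
    (hB : s₁ * (s₂ + d₂) < (s₁ + d₁) * d₂) :
    q ≤ m₁ * d₁ + m₂ * d₂ + p₁₁ * (s₁ * (s₂ + d₂) - (s₁ + d₁) * d₂) := by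
  set u₁ := s₁ + d₁ with hu₁def
  set u₂ := s₂ + d₂ with hu₂def
  set κ := u₁ * d₂ - s₁ * u₂ with hκ
  have hκpos : 0 < κ := by rw [hκ]; linarith
  -- replace `p₁₁` by `m₁` (the coefficient of `p₁₁` is `−κ < 0`)
  have hT : m₁ * d₁ + m₂ * d₂ + m₁ * (s₁ * u₂ - u₁ * d₂) ≤ m₁ * d₁ + m₂ * d₂ + p₁₁ * (s₁ * u₂ - u₁ * d₂) := by
    have : (m₁ - p₁₁) * κ ≥ 0 := mul_nonneg (by linarith) hκpos.le
    nlinarith [this]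
  refine le_trans ?_ hT
  -- `T := m₁d₁(1−u₂) + m₁u₁s₂ + m₂d₂` equals the left side
  have hTeq : m₁ * d₁ + m₂ * d₂ + m₁ * (s₁ * u₂ - u₁ * d₂) = m₁ * d₁ * (1 - u₂) + m₁ * u₁ * s₂ + m₂ * d₂ := by
    rw [hu₁def, hu₂def]; ring
  rw [hTeq]
  have hu₁pos : 0 < u₁ := by
    rcases lt_or_eq_of_le (add_nonneg hs₁ hd₁ : (0 : ℝ) ≤ s₁ + d₁) with h | h
    · exact h
    · exfalso; rw [← hu₁def] at h; rw [← h] at hB; nlinarith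
  have hd₂pos : 0 < d₂ := by
    rcases lt_or_eq_of_le hd₂ with h | h
    · exact h
    · exfalso; rw [← h] at hB; nlinarith
  have hu₂pos : 0 < u₂ := by rw [hu₂def]; linarith
  have hTnn : 0 ≤ m₁ * d₁ * (1 - u₂) + m₁ * u₁ * s₂ + m₂ * d₂ := by
    have : 0 ≤ 1 - u₂ := by linarith
    positivity
  rcases le_or_gt q 0 with hq0 | hq0
  · linarith
  -- multiply by `u₁u₂ > 0`
  have hmain : q * (u₁ * u₂) ≤ (m₁ * d₁ * (1 - u₂) + m₁ * u₁ * s₂ + m₂ * d₂) * (u₁ * u₂) := by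
    have e1 : q * (d₁ * (1 - u₂) * u₂) ≤ m₁ * u₁ * (d₁ * (1 - u₂) * u₂) :=
      mul_le_mul_of_nonneg_right hq₁ (mul_nonneg (mul_nonneg hd₁ (by linarith)) hu₂pos.le)
    have e2 : q * (u₁ * u₂ * s₂) ≤ m₁ * u₁ * (u₁ * u₂ * s₂) :=
      mul_le_mul_of_nonneg_right hq₁ (mul_nonneg (mul_nonneg hu₁pos.le hu₂pos.le) hs₂)
    have e3 : q * (d₂ * u₁) ≤ m₂ * u₂ * (d₂ * u₁) :=
      mul_le_mul_of_nonneg_right hq₂ (mul_nonneg hd₂pos.le hu₁pos.le)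
    -- `d₁u₂(1−u₂) + u₁u₂s₂ + u₁d₂ − u₁u₂ = (1 − u₂)·κ ≥ 0`
    have hid : d₁ * (1 - u₂) * u₂ + u₁ * u₂ * s₂ + d₂ * u₁ - u₁ * u₂ = (1 - u₂) * κ := by
      rw [hκ, hu₂def]; ring
    have hge : u₁ * u₂ ≤ d₁ * (1 - u₂) * u₂ + u₁ * u₂ * s₂ + d₂ * u₁ := by
      have : 0 ≤ (1 - u₂) * κ := mul_nonneg (by linarith) hκpos.le
      linarith [hid]
    have hq' : q * (u₁ * u₂) ≤ q * (d₁ * (1 - u₂) * u₂ + u₁ * u₂ * s₂ + d₂ * u₁) :=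
      mul_le_mul_of_nonneg_left hge hq0.le
    nlinarith [e1, e2, e3, hq']
  exact le_of_mul_le_mul_right hmain (mul_pos hu₁pos hu₂pos)

/-- `P(X ≥ 2) ≤ P(X ≥ 1)` at law level: `t_S ≤ h_S` (`p₁₁ ≤ mᵢ`, `uᵢ ≤ 1`). [this work] -/
theorem twoAnchor_one_le_two (m₁ m₂ p₁₁ s₁ d₁ s₂ d₂ : ℝ)
    (hp₀ : 0 ≤ p₁₁) (hp₁ : p₁₁ ≤ m₁) (hp₂ : p₁₁ ≤ m₂)
    (hs₁ : 0 ≤ s₁) (hs₂ : 0 ≤ s₂) (hu₁ : s₁ + d₁ ≤ 1) (hu₂ : s₂ + d₂ ≤ 1) :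
    m₁ * d₁ + m₂ * d₂ + p₁₁ * (s₁ * (s₂ + d₂) - (s₁ + d₁) * d₂) ≤
      m₁ * (s₁ + d₁) + m₂ * (s₂ + d₂) - p₁₁ * (s₁ + d₁) * (s₂ + d₂) := by
  have key : m₁ * (s₁ + d₁) + m₂ * (s₂ + d₂) - p₁₁ * (s₁ + d₁) * (s₂ + d₂) -
      (m₁ * d₁ + m₂ * d₂ + p₁₁ * (s₁ * (s₂ + d₂) - (s₁ + d₁) * d₂)) =
      s₁ * (m₁ - p₁₁ * (s₂ + d₂)) + s₂ * (m₂ - p₁₁ * (s₁ + d₁)) := by ring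
  have h1 : 0 ≤ s₁ * (m₁ - p₁₁ * (s₂ + d₂)) := mul_nonneg hs₁ (by nlinarith)
  have h2 : 0 ≤ s₂ * (m₂ - p₁₁ * (s₁ + d₁)) := mul_nonneg hs₂ (by nlinarith)
  linarith [key, h1, h2]

/-- **Two-anchor domination.**  With `h_S, t_S` the block's `P(X ≥ 1), P(X ≥ 2)` and `h', t'` those of the decoupled block (formulas in the
module docstring), `m₁m₂ ≤ p₁₁ ≤ min(m₁,m₂)` (Harris / monotonicity) and `q ≤ mᵢuᵢ`: there is `λ ∈ [0, 1]` with
`λh' + (1−λ)q ≤ h_S` and `λt' + (1−λ)q ≤ t_S`.  Case A: `λ = 1 − εu₁u₂/(h' − q)` (`ε = p₁₁ − m₁m₂`), first coordinate tight,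
second by `twoAnchor_caseA`; Case B: `λ = 0` by `twoAnchor_caseB`. [this work] -/
theorem twoAnchor_dominates (m₁ m₂ p₁₁ s₁ d₁ s₂ d₂ q hS tS hP tP : ℝ)
    (hm₁ : 0 ≤ m₁) (hm₂ : 0 ≤ m₂) (hp₁ : p₁₁ ≤ m₁) (hp₂ : p₁₁ ≤ m₂) (hpm : m₁ * m₂ ≤ p₁₁)
    (hs₁ : 0 ≤ s₁) (hd₁ : 0 ≤ d₁) (hs₂ : 0 ≤ s₂) (hd₂ : 0 ≤ d₂) (hu₁ : s₁ + d₁ ≤ 1) (hu₂ : s₂ + d₂ ≤ 1)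
    (hq₁ : q ≤ m₁ * (s₁ + d₁)) (hq₂ : q ≤ m₂ * (s₂ + d₂))
    (hhS : hS = m₁ * (s₁ + d₁) + m₂ * (s₂ + d₂) - p₁₁ * (s₁ + d₁) * (s₂ + d₂))
    (htS : tS = m₁ * d₁ + m₂ * d₂ + p₁₁ * (s₁ * (s₂ + d₂) - (s₁ + d₁) * d₂))
    (hhP : hP = m₁ * (s₁ + d₁) + m₂ * (s₂ + d₂) - m₁ * m₂ * (s₁ + d₁) * (s₂ + d₂))
    (htP : tP = m₁ * d₁ + m₂ * d₂ + m₁ * m₂ * (s₁ * (s₂ + d₂) - (s₁ + d₁) * d₂)) :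
    ∃ lam : ℝ, 0 ≤ lam ∧ lam ≤ 1 ∧ lam * hP + (1 - lam) * q ≤ hS ∧ lam * tP + (1 - lam) * q ≤ tS := by
  set u₁ := s₁ + d₁ with hu₁def
  set u₂ := s₂ + d₂ with hu₂def
  set ε := p₁₁ - m₁ * m₂ with hεdef
  set κ' := s₁ * u₂ - u₁ * d₂ with hκ'
  have hε : 0 ≤ ε := by rw [hεdef]; linarith
  have hp₀ : 0 ≤ p₁₁ := le_trans (mul_nonneg hm₁ hm₂) hpm
  have hu₁0 : 0 ≤ u₁ := add_nonneg hs₁ hd₁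
  have hu₂0 : 0 ≤ u₂ := add_nonneg hs₂ hd₂
  -- `h_S = h' − εu₁u₂`, `t_S = t' + εκ'`
  have hSP : hS = hP - ε * u₁ * u₂ := by rw [hhS, hhP, hεdef]; ring
  have tSP : tS = tP + ε * κ' := by rw [htS, htP, hεdef, hκ']; ring
  -- `h_S ≥ m₁u₁ ≥ q`
  have hSq : q ≤ hS := by
    have : hS = m₁ * u₁ + u₂ * (m₂ - p₁₁ * u₁) := by rw [hhS]; ring
    have h2 : 0 ≤ u₂ * (m₂ - p₁₁ * u₁) := mul_nonneg hu₂0 (by nlinarith)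
    linarith
  have htShS : tS ≤ hS := by
    rw [hhS, htS]; exact twoAnchor_one_le_two m₁ m₂ p₁₁ s₁ d₁ s₂ d₂ hp₀ hp₁ hp₂ hs₁ hs₂ hu₁ hu₂
  rcases lt_or_ge κ' 0 with hB | hA
  · -- Case B: exit, `λ = 0`
    have hB' : s₁ * (s₂ + d₂) < (s₁ + d₁) * d₂ := by rw [hκ'] at hB; linarith
    have htq : q ≤ tS := by
      rw [htS]; exact twoAnchor_caseB m₁ m₂ p₁₁ s₁ d₁ s₂ d₂ q hm₁ hm₂ hp₁ hs₁ hd₁ hs₂ hd₂ hu₂ hq₁ hq₂ hB'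
    exact ⟨0, le_refl _, zero_le_one, by linarith, by linarith⟩
  · -- Case A
    rcases le_or_gt hP q with hPq | hPq
    · -- degenerate: `h' ≤ q ≤ h_S = h' − εu₁u₂` forces `εu₁u₂ = 0`; take `λ = 1`
      refine ⟨1, zero_le_one, le_refl _, by linarith, ?_⟩
      have : 0 ≤ ε * κ' := mul_nonneg hε hA
      linarith
    · -- `λ = 1 − μ`, `μ = εu₁u₂/(h' − q)`
      have hgap : 0 < hP - q := by linarith
      set μ := ε * u₁ * u₂ / (hP - q) with hμdef
      have hεuu : 0 ≤ ε * u₁ * u₂ := mul_nonneg (mul_nonneg hε hu₁0) hu₂0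
      have hμ0 : 0 ≤ μ := div_nonneg hεuu hgap.le
      have hμgap : μ * (hP - q) = ε * u₁ * u₂ := div_mul_cancel₀ _ (ne_of_gt hgap)
      have hμ1 : μ ≤ 1 := by rw [hμdef, div_le_one hgap]; linarith
      refine ⟨1 - μ, by linarith, by linarith, ?_, ?_⟩
      · -- first coordinate is an equality
        have : (1 - μ) * hP + (1 - (1 - μ)) * q = hP - μ * (hP - q) := by ring
        rw [this, hμgap, hSP]
      · -- second coordinate: Case A inequality
        have hcase := twoAnchor_caseA m₁ m₂ s₁ d₁ s₂ d₂ q hs₁ hd₁ hs₂ hd₂ hq₁ hq₂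
        -- in the abbreviations: `u₁u₂(q − t') ≤ κ'(h' − q)`
        have hcase' : u₁ * u₂ * (q - tP) ≤ κ' * (hP - q) := by
          rw [htP, hhP, hκ', hu₁def, hu₂def]; exact hcase
        have hid : (1 - μ) * tP + (1 - (1 - μ)) * q = tP + μ * (q - tP) := by ring
        rw [hid, tSP]
        -- `μ(q − t') ≤ εκ'`: multiply by `h' − q > 0`
        have h3 : μ * (q - tP) * (hP - q) ≤ ε * κ' * (hP - q) := by
          have e1 : μ * (q - tP) * (hP - q) = ε * (u₁ * u₂ * (q - tP)) := by
            calc μ * (q - tP) * (hP - q) = μ * (hP - q) * (q - tP) := by ring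
              _ = ε * u₁ * u₂ * (q - tP) := by rw [hμgap]
              _ = ε * (u₁ * u₂ * (q - tP)) := by ring
          have e2 : ε * (u₁ * u₂ * (q - tP)) ≤ ε * (κ' * (hP - q)) := mul_le_mul_of_nonneg_left hcase' hε
          calc μ * (q - tP) * (hP - q) = ε * (u₁ * u₂ * (q - tP)) := e1
            _ ≤ ε * (κ' * (hP - q)) := e2
            _ = ε * κ' * (hP - q) := by ring
        have h4 : μ * (q - tP) ≤ ε * κ' := le_of_mul_le_mul_right h3 hgap
        linarith

end Block

end Quant

end Summit.CriticalPhenomena.PercolationContinuityZ3.Theorems
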